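import Summits.NavierStokesRegularity.FluidComputer.ClayBlowupLocalZoomUniform
import Summits.NavierStokesRegularity.FluidComputer.ClayBlowupLocalAlignment
import Summits.NavierStokesRegularity.FluidComputer.ClayBlowupForcedAxisDecay
import Summits.NavierStokesRegularity.FluidComputer.ClayBlowupSingularSliceAxis
import HarnessLib

/-!
# LOCAL KNSS THEOREM 6.1 WITH THE CLAY FORCE: for an axisymmetric Clay blow-up, `r‖u‖` is unbounded
# in EVERY neighbourhood of EVERY singular point

Cell `ns-blowup`, seat `ns-blowup-ecbridge-2` (g11; the E–C endpoint theory seat). LABEL: E–C typing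
(KERNEL — no named fact, no new definition). WHAT THIS IS NOT: not Navier–Stokes evidence — a
necessary condition on the TYPE `ClayBlowup ν` with its Clay force; no inhabitant is claimed.
Companion memo: `run/shared/lean/pub/ns-blowup/ecbridge2/ECBRIDGE-2-MEMO-10.md`.

## Content

g10's `ClayBlowup.not_cylRadius_mul_norm_le_of_isAxisymmetric` (KNSS 2009 Thm 6.1 WITH the Clay
force) refutes a GLOBAL bound `r‖u(t, x)‖ ≤ C` on `[0, T) × ℝ³`, because its zoom is centred at global
near-maxima. With the LOCAL zoom in its uniform export (`exists_local_zoom_limit_uniform`) the bound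
localises to `(t₀, T) × B(x₁, r₀)` around any one singular point `x₁` (which lies on the axis,
`cylRadius_eq_zero_of_not_isBackwardBoundedAt`):

* `ClayBlowup.not_local_cylRadius_mul_norm_le_one` — the `ν = 1` core: axisymmetric slices, `x₁` on
  the axis and not backward bounded, `r‖u‖ ≤ C` on `(t₀, T) × B(x₁, r₀)` ⇒ `False`.
* **`ClayBlowup.not_local_cylRadius_mul_norm_le_of_isAxisymmetric`** (every `ν > 0`, axisymmetric
  datum and force) and **`ClayBlowup.exists_local_cylRadius_mul_norm_gt`**: `r‖u‖` exceeds every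
  constant inside every `(t₀, T) × B(x₁, r₀)`; `DesignedBlowup` twin.

Proof of the core (KNSS's proof of Thm 6.1 on the LOCAL zoom): the rescaled axial offsets
`b_k = −c_k⁻¹ (y_k)'` are bounded by `C` (the local bound at the centres), a subsequence converges to
`b₀`; the zoom slices converge LOCALLY UNIFORMLY, hence at the moving points `b_k + z → b₀ + z`, so the
shifted limit `W(s, · + b₀)` is axisymmetric with `|z'| ‖W‖ ≤ C` (the physical points
`(y_k)₃ e₃ + c_k z` enter `B(x₁, r₀)` because `x₁` is on the axis and `|y_k'| ≤ ‖y_k − x₁‖`); KNSS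
Thm 5.3 (`KNSS2009_liouville_bound_C_over_r_holds`) kills it on `(−∞, 0) × ℝ³`, against
`‖W(−σ₁/2, 0)‖ ≥ 1/2`.

References: Koch–Nadirashvili–Seregin–Šverák, Acta Math. 203 (2009), Thm 6.1 and its proof, Thm 5.3
[cite: KochNadirashviliSereginSverak2009, Thm 6.1 and its proof (arXiv p. 12), Thm 5.3]; C. L.
Fefferman, (C) [cite: FeffermanClay2006, (C)].
-/

noncomputable section

namespace Summit.NavierStokesRegularity.FluidComputer

open Set MeasureTheory Filter Topology Function Metric
open scoped ENNReal NNReal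
open Literature.Analysis Literature.Analysis.FluidPDE
open Literature.Analysis.FluidPDE.SereginSverak2009
open Summit.NavierStokesRegularity.NavierStokesRegularity

namespace ClayBlowup

variable {ν : ℝ} (X : ClayBlowup ν)

set_option maxHeartbeats 800000 in
-- one long bookkeeping proof: offsets, three passages to the limit, Liouville
/-- **LOCAL KNSS THEOREM 6.1 WITH THE CLAY FORCE, `ν = 1` CORE** (no named fact): if every slice
`u(t)`, `t ∈ [0, T)`, is axisymmetric, `x₁` lies on the axis and is not backward bounded at `T`, then
no bound `cylRadius x · ‖u(t, x)‖ ≤ C` holds on `(t₀, T) × B(x₁, r₀)`.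
[cite: KochNadirashviliSereginSverak2009, Thm 6.1 and its proof (arXiv p. 12), Thm 5.3] -/
theorem not_local_cylRadius_mul_norm_le_one (Y : ClayBlowup 1)
    (hax : ∀ t ∈ Ico 0 Y.T, IsAxisymmetric (Y.u t)) {x₁ : EuclideanSpace ℝ (Fin 3)}
    (hx₁ax : cylRadius x₁ = 0) (hx₁ : ¬ IsBackwardBoundedAt Y.u Y.T x₁) {r₀ : ℝ} (hr₀ : 0 < r₀)
    {t₀ : ℝ} (ht₀ : t₀ < Y.T) {C : ℝ}
    (hC : ∀ t ∈ Ioo t₀ Y.T, ∀ x ∈ ball x₁ r₀, cylRadius x * ‖Y.u t x‖ ≤ C) : False := by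
  have hT := Y.T_pos
  -- `x₁` is on the axis: `|y'| ≤ ‖y − x₁‖`
  have hx₁0 : x₁ 0 = 0 ∧ x₁ 1 = 0 := by
    have h : x₁ 0 ^ 2 + x₁ 1 ^ 2 ≤ 0 := Real.sqrt_eq_zero'.1 hx₁ax
    constructor <;> nlinarith [sq_nonneg (x₁ 0), sq_nonneg (x₁ 1)]
  have hcyl : ∀ z : EuclideanSpace ℝ (Fin 3), cylRadius z ≤ ‖z - x₁‖ := fun z => by
    have e : cylRadius z = cylRadius (z - x₁) := by
      simp [cylRadius, hx₁0.1, hx₁0.2]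
    rw [e]; exact cylRadius_le_norm' _
  -- ### the local zoom at `x₁` (uniform export), centres in `B(x₁, min 1 (r₀/4))`, times after `t₀`
  have hr' : 0 < min 1 (r₀ / 4) := lt_min one_pos (by positivity)
  have hmax : max t₀ 0 < Y.T := max_lt ht₀ hT
  have ht_b : (max t₀ 0 + Y.T) / 2 ∈ Ico 0 Y.T :=
    ⟨by linarith [le_max_right t₀ 0], by linarith⟩
  obtain ⟨τ, y, φ, W, hφ, hτ, hy, hk1, -, hWc, hWdiv, hWmild, hW4, ⟨σ₁, hσ₁, hhalf⟩, -, hWlu, -⟩ :=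
    Y.exists_local_zoom_limit_uniform hx₁ hr' (min_le_left _ _) ht_b
  obtain ⟨c, hc⟩ : ∃ c : ℕ → ℝ, ∀ k, c k = ‖Y.u (τ k) (y k)‖⁻¹ := ⟨_, fun k => rfl⟩
  simp_rw [← hc] at hWlu
  have hM0 : ∀ k, 0 < ‖Y.u (τ k) (y k)‖ := fun k => lt_of_lt_of_le (by positivity) (hk1 k)
  have hc0 : ∀ k, 0 < c k := fun k => by rw [hc k]; exact inv_pos.2 (hM0 k)
  have htI : ∀ k, τ k ∈ Ioo 0 Y.T := fun k =>
    ⟨lt_of_lt_of_le (by linarith [le_max_right t₀ 0]) (hτ k).1, (hτ k).2⟩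
  have hτ₀ : ∀ k, t₀ < τ k := fun k =>
    lt_of_lt_of_le (by linarith [le_max_left t₀ 0]) (hτ k).1
  have hyr : ∀ k, ‖y k - x₁‖ < r₀ / 4 := fun k => by
    rw [← dist_eq_norm]; exact lt_of_lt_of_le (mem_ball.1 (hy k)) (min_le_right _ _)
  have hyr₀ : ∀ k, y k ∈ ball x₁ r₀ := fun k => by
    rw [mem_ball, dist_eq_norm]; linarith [hyr k]
  -- ### the rescaled axial offsets `b_k = −c_k⁻¹ (y_k)'`, `‖b_k‖ ≤ C`
  set b : ℕ → EuclideanSpace ℝ (Fin 3) := fun k => -((c k)⁻¹ • horiz (y k)) with hb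
  have hb_norm : ∀ k, ‖b k‖ ≤ C := by
    intro k
    rw [hb]
    simp only [norm_neg]
    rw [norm_inv_smul_horiz (hc0 k), hc, inv_inv, mul_comm]
    exact hC (τ k) ⟨hτ₀ k, (hτ k).2⟩ (y k) (hyr₀ k)
  have hb_axis : ∀ k (z : EuclideanSpace ℝ (Fin 3)),
      y k + c k • (b k + z) = (y k) 2 • eZ + c k • z := by
    intro k z
    rw [hb, smul_add, smul_neg, smul_inv_smul_horiz (hc0 k).ne', ← add_assoc]
    congr 1
    have h := horiz_add_smul_eZ (y k)
    rw [← h]; abel_nf; rw [h]; simp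
  -- the physical points `(y_k)₃ e₃ + c_k z` lie in `B(x₁, r₀)` once `c_k ‖z‖ < r₀/2`
  have hphys : ∀ k (z : EuclideanSpace ℝ (Fin 3)), c k * ‖z‖ < r₀ / 2 →
      (y k) 2 • eZ + c k • z ∈ ball x₁ r₀ := by
    intro k z hz
    rw [mem_ball, dist_eq_norm]
    have e : (y k) 2 • eZ + c k • z - x₁ = (y k - x₁) - horiz (y k) + c k • z := by
      have h := horiz_add_smul_eZ (y k)
      rw [← sub_eq_of_eq_add' h.symm]; abel
    rw [e]
    have h1 : ‖horiz (y k)‖ ≤ ‖y k - x₁‖ := by rw [norm_horiz]; exact hcyl _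
    have h2 : ‖c k • z‖ < r₀ / 2 := by rwa [norm_smul, Real.norm_of_nonneg (hc0 k).le]
    calc ‖(y k - x₁) - horiz (y k) + c k • z‖
        ≤ ‖(y k - x₁) - horiz (y k)‖ + ‖c k • z‖ := norm_add_le _ _
      _ ≤ ‖y k - x₁‖ + ‖horiz (y k)‖ + ‖c k • z‖ := by gcongr; exact norm_sub_le _ _
      _ < r₀ / 4 + r₀ / 4 + r₀ / 2 := by linarith [hyr k]
      _ = r₀ := by ring
  -- a convergent subsequence of the offsets
  obtain ⟨bₒ, -, ψ, hψ, hbψ⟩ := tendsto_subseq_of_bounded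
    (isBounded_closedBall (x := (0 : EuclideanSpace ℝ (Fin 3))) (r := C))
    (x := fun j => b (φ j)) (fun j => mem_closedBall_zero_iff.2 (hb_norm (φ j)))
  have hbψ' : Tendsto (fun j => b (φ (ψ j))) atTop (𝓝 bₒ) := hbψ
  have hφψ : Tendsto (fun j => φ (ψ j)) atTop atTop := hφ.tendsto_atTop.comp hψ.tendsto_atTop
  -- ### slice times → T⁻ and amplitudes → 0 (along `k`)
  have htT : Tendsto τ atTop (𝓝[<] Y.T) := Y.tendsto_of_norm_ge one_pos htI hk1
  have hcto : Tendsto c atTop (𝓝 0) := by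
    have hMto : Tendsto (fun k => ‖Y.u (τ k) (y k)‖) atTop atTop := by
      refine tendsto_atTop_atTop.2 fun B => ⟨⌈B⌉₊, fun k hk => ?_⟩
      have h1 : (⌈B⌉₊ : ℝ) ≤ k := by exact_mod_cast hk
      linarith [Nat.le_ceil B, hk1 k]
    exact (tendsto_inv_atTop_zero.comp hMto).congr fun k => by simp [Function.comp, hc k]
  have htime : ∀ s ≤ 0, ∀ᶠ k in atTop, τ k + c k ^ 2 * s ∈ Ioo (max t₀ 0) Y.T := by
    intro s hs
    have h1 : Tendsto (fun k => τ k + c k ^ 2 * s) atTop (𝓝 Y.T) := by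
      simpa using (tendsto_nhdsWithin_iff.1 htT).1.add ((hcto.pow 2).mul_const s)
    have h2 : Tendsto (fun k => τ k + c k ^ 2 * s) atTop (𝓝[<] Y.T) := by
      refine tendsto_nhdsWithin_iff.2 ⟨h1, Eventually.of_forall fun k => ?_⟩
      have : c k ^ 2 * s ≤ 0 := mul_nonpos_of_nonneg_of_nonpos (sq_nonneg _) hs
      exact lt_of_le_of_lt (by linarith) (hτ k).2
    exact h2.eventually (Ioo_mem_nhdsLT hmax)
  have hsmall : ∀ A : ℝ, ∀ᶠ k in atTop, c k * A < r₀ / 2 := fun A => by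
    have h : Tendsto (fun k => c k * A) atTop (𝓝 (0 * A)) := hcto.mul_const A
    rw [zero_mul] at h
    exact h.eventually (gt_mem_nhds (by positivity))
  -- ### the shifted limit `V(s, z) = W(s, z + bₒ)`
  have hWslice : ∀ s < 0, Continuous (W s) := fun s hs =>
    hWc.comp_continuous (Continuous.prodMk_right s) fun z => ⟨hs, mem_univ z⟩
  have hconvψ : ∀ s < 0, TendstoLocallyUniformly
      (fun j z => c (φ (ψ j)) • Y.u (τ (φ (ψ j)) + c (φ (ψ j)) ^ 2 * s)
        (y (φ (ψ j)) + c (φ (ψ j)) • z)) (W s) atTop := fun s hs =>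
    tendstoLocallyUniformly_comp_of_tendsto (hWlu s hs) hψ.tendsto_atTop
  -- pointwise limits at the moving points `b_{φ ψ j} + z → bₒ + z`
  have hlim : ∀ s < 0, ∀ z : EuclideanSpace ℝ (Fin 3), Tendsto
      (fun j => c (φ (ψ j)) • Y.u (τ (φ (ψ j)) + c (φ (ψ j)) ^ 2 * s)
        (y (φ (ψ j)) + c (φ (ψ j)) • (b (φ (ψ j)) + z))) atTop (𝓝 (W s (bₒ + z))) := by
    intro s hs z
    exact (hconvψ s hs).tendsto_comp (hWslice s hs).continuousAt (hbψ'.add tendsto_const_nhds)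
  -- (i) axisymmetry of the shifted limit
  have hVax : ∀ s < 0, IsAxisymmetric (fun z => W s (z + bₒ)) := by
    intro s hs θ z
    simp only
    rw [add_comm (rotZ θ z) bₒ, add_comm z bₒ]
    have h1 := hlim s hs (rotZ θ z)
    have h2 : Tendsto (fun j => rotZ θ (c (φ (ψ j)) • Y.u (τ (φ (ψ j)) + c (φ (ψ j)) ^ 2 * s)
        (y (φ (ψ j)) + c (φ (ψ j)) • (b (φ (ψ j)) + z)))) atTop (𝓝 (rotZ θ (W s (bₒ + z)))) :=
      (continuous_rotZ θ).continuousAt.tendsto.comp (hlim s hs z)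
    have hev : ∀ᶠ j in atTop, c (φ (ψ j)) • Y.u (τ (φ (ψ j)) + c (φ (ψ j)) ^ 2 * s)
        (y (φ (ψ j)) + c (φ (ψ j)) • (b (φ (ψ j)) + rotZ θ z)) =
        rotZ θ (c (φ (ψ j)) • Y.u (τ (φ (ψ j)) + c (φ (ψ j)) ^ 2 * s)
          (y (φ (ψ j)) + c (φ (ψ j)) • (b (φ (ψ j)) + z))) := by
      filter_upwards [hφψ.eventually (htime s hs.le)] with j hj
      rw [hb_axis, hb_axis]
      exact isAxisymmetric_rescale (hax _ ⟨(le_max_right t₀ 0).trans hj.1.le, hj.2⟩)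
        (c (φ (ψ j))) ((y (φ (ψ j))) 2) (c (φ (ψ j))) θ z
    exact tendsto_nhds_unique (h1.congr' hev) h2
  -- (ii) the scale-invariant bound of the shifted limit
  have hVC : ∀ s < 0, ∀ z : EuclideanSpace ℝ (Fin 3), cylRadius z * ‖W s (z + bₒ)‖ ≤ C := by
    intro s hs z
    rw [add_comm z bₒ]
    have h1 : Tendsto (fun j => cylRadius z * ‖c (φ (ψ j)) • Y.u (τ (φ (ψ j)) + c (φ (ψ j)) ^ 2 * s)
        (y (φ (ψ j)) + c (φ (ψ j)) • (b (φ (ψ j)) + z))‖) atTop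
        (𝓝 (cylRadius z * ‖W s (bₒ + z)‖)) := ((hlim s hs z).norm).const_mul _
    have hev : ∀ᶠ j in atTop, cylRadius z * ‖c (φ (ψ j)) • Y.u (τ (φ (ψ j)) + c (φ (ψ j)) ^ 2 * s)
        (y (φ (ψ j)) + c (φ (ψ j)) • (b (φ (ψ j)) + z))‖ ≤ C := by
      filter_upwards [hφψ.eventually (htime s hs.le), hφψ.eventually (hsmall ‖z‖)] with j hj hjz
      set k := φ (ψ j) with hk
      rw [hb_axis, norm_smul, Real.norm_eq_abs, abs_of_pos (hc0 k)]
      have h := hC _ ⟨(le_max_left t₀ 0).trans_lt hj.1, hj.2⟩ ((y k) 2 • eZ + c k • z)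
        (hphys k z hjz)
      rw [cylRadius_smul_eZ_add, cylRadius_smul, abs_of_pos (hc0 k)] at h
      calc cylRadius z * (c k * ‖Y.u (τ k + c k ^ 2 * s) ((y k) 2 • eZ + c k • z)‖)
          = c k * cylRadius z * ‖Y.u (τ k + c k ^ 2 * s) ((y k) 2 • eZ + c k • z)‖ := by ring
        _ ≤ C := h
    exact le_of_tendsto h1 hev
  -- (iii) the shifted limit is a bounded weak solution on `ℝ³ × (−∞, 0)`
  have hVcont : ContinuousOn (uncurry fun s z => W s (z + bₒ)) (Iio 0 ×ˢ univ) := by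
    have hmap : Continuous fun p : ℝ × EuclideanSpace ℝ (Fin 3) => (p.1, p.2 + bₒ) :=
      continuous_fst.prodMk (continuous_snd.add continuous_const)
    exact hWc.comp hmap.continuousOn fun p hp => ⟨hp.1, mem_univ _⟩
  have hVweak : IsBoundedWeakNSSolutionOn (Iio 0) isOpen_Iio 1 (fun s z => W s (z + bₒ)) := by
    refine isBoundedWeakNSSolutionOn_of_oseen one_pos hVcont ⟨4, fun s hs z => hW4 s hs _⟩
      (fun s hs => (hWdiv s hs).comp_add_right' bₒ) fun s σ hsσ hσ z => ?_
    show W σ (z + bₒ) = UnboundedOperators.heatExtension (fun z' => W s (z' + bₒ)) (1 * (σ - s)) z -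
      oseenDuhamel 1 s (fun σ' z' => W σ' (z' + bₒ)) (fun σ' z' => W σ' (z' + bₒ)) σ z
    rw [one_mul, oseenDuhamel_comp_add_right 1 s W W bₒ σ z, heatExtension_comp_add_right'',
      hWmild s σ hsσ hσ (z + bₒ)]
  -- (iv) Liouville: the shifted limit vanishes on `(−∞, 0) × ℝ³`
  have hzero := KNSS2009_liouville_bound_C_over_r_holds hVweak
    (fun θ => ae_rotZ_of_isAxisymmetric (fun s hs => hVax s hs) θ)
    ⟨C, ae_cylRadius_mul_norm_le_of_forall fun s hs z => hVC s hs z⟩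
  have hslab := ae_eq_zero_slab_of_ae_slice (u := fun s z => W s (z + bₒ))
    (hVcont.aestronglyMeasurable (measurableSet_Iio.prod MeasurableSet.univ)) hzero
  have heqOn : EqOn (uncurry fun s z => W s (z + bₒ)) 0
      (Iio (0 : ℝ) ×ˢ (univ : Set (EuclideanSpace ℝ (Fin 3)))) :=
    Measure.eqOn_open_of_ae_eq hslab (isOpen_Iio.prod isOpen_univ) hVcont continuousOn_const
  have hWneg : ∀ s < 0, W s 0 = 0 := by
    intro s hs
    have h := heqOn (show ((s, -bₒ) : ℝ × EuclideanSpace ℝ (Fin 3)) ∈ Iio 0 ×ˢ univ from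
      ⟨hs, mem_univ _⟩)
    simpa using h
  -- (v) against the nontriviality of the local zoom limit near the vertex
  have h := hhalf (-(σ₁ / 2)) ⟨by linarith, by linarith⟩
  rw [hWneg _ (by linarith), norm_zero] at h
  linarith

/-! ## §2 Every viscosity; the headline -/

/-- **LOCAL KNSS THEOREM 6.1 WITH THE CLAY FORCE** (`ν > 0`; no named fact): for a Clay blow-up with
axisymmetric datum and axisymmetric Clay force and ANY point `x₁` which is not backward bounded at
`T`, NO bound `cylRadius x · ‖u(t, x)‖ ≤ C` holds on `(t₀, T) × B(x₁, r₀)`, however small `r₀ > 0`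
and `T − t₀ > 0` are. Localises g10's `not_cylRadius_mul_norm_le_of_isAxisymmetric` (global bound);
viscosity normalised by `rescale` (a time dilation — balls unchanged).
[cite: KochNadirashviliSereginSverak2009, Thm 6.1 and its proof (arXiv p. 12), Thm 5.3] -/
theorem not_local_cylRadius_mul_norm_le_of_isAxisymmetric (hν : 0 < ν)
    (h0A : IsAxisymmetric (X.u 0)) (hfA : ∀ t ∈ Ico 0 X.T, IsAxisymmetric (X.f t))
    {x₁ : EuclideanSpace ℝ (Fin 3)} (hx₁ : ¬ IsBackwardBoundedAt X.u X.T x₁) {r₀ : ℝ} (hr₀ : 0 < r₀)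
    {t₀ : ℝ} (ht₀ : t₀ < X.T) :
    ¬ ∃ C : ℝ, ∀ t ∈ Ioo t₀ X.T, ∀ x ∈ ball x₁ r₀, cylRadius x * ‖X.u t x‖ ≤ C := by
  rintro ⟨C, hC⟩
  have hax : ∀ t ∈ Ico 0 X.T, IsAxisymmetric (X.u t) := X.isAxisymmetric hν h0A hfA
  have hx₁ax : cylRadius x₁ = 0 := X.cylRadius_eq_zero_of_not_isBackwardBoundedAt hν h0A hfA hx₁
  set a : ℝ := 1 / ν with ha
  have ha0 : 0 < a := by positivity
  set Y : ClayBlowup 1 := X.rescale hν one_pos with hY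
  have hYu : ∀ s z, Y.u s z = a • X.u (a * s) z := fun s z => X.rescale_u_apply hν one_pos s z
  have hYT : Y.T = X.T / a := X.rescale_T hν one_pos
  have hmaps : ∀ s ∈ Ico 0 Y.T, a * s ∈ Ico 0 X.T := by
    intro s hs
    rw [hYT] at hs
    refine ⟨mul_nonneg ha0.le hs.1, ?_⟩
    have := mul_lt_mul_of_pos_left hs.2 ha0
    rwa [mul_div_cancel₀ _ ha0.ne'] at this
  have hYax : ∀ s ∈ Ico 0 Y.T, IsAxisymmetric (Y.u s) := by
    intro s hs
    have h := (hax (a * s) (hmaps s hs)).const_smul a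
    have e : Y.u s = fun z => a • X.u (a * s) z := funext (hYu s)
    rw [e]; exact h
  have hYx₁ : ¬ IsBackwardBoundedAt Y.u Y.T x₁ := fun h =>
    hx₁ (X.isBackwardBoundedAt_of_rescale hν one_pos h)
  have ht₀' : t₀ / a < Y.T := by rw [hYT]; exact div_lt_div_of_pos_right ht₀ ha0
  refine Y.not_local_cylRadius_mul_norm_le_one hYax hx₁ax hYx₁ hr₀ ht₀' (C := a * C)
    fun s hs z hz => ?_
  have has : a * s ∈ Ioo t₀ X.T := by
    rw [hYT] at hs
    constructor
    · have := mul_lt_mul_of_pos_left hs.1 ha0; rwa [mul_div_cancel₀ _ ha0.ne'] at this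
    · have := mul_lt_mul_of_pos_left hs.2 ha0; rwa [mul_div_cancel₀ _ ha0.ne'] at this
  rw [hYu, norm_smul, Real.norm_eq_abs, abs_of_pos ha0]
  calc cylRadius z * (a * ‖X.u (a * s) z‖) = a * (cylRadius z * ‖X.u (a * s) z‖) := by ring
    _ ≤ a * C := mul_le_mul_of_nonneg_left (hC (a * s) has z hz) ha0.le

/-- **FOR AN AXISYMMETRIC CLAY BLOW-UP — WITH ITS CLAY FORCE — `r‖u‖` IS UNBOUNDED IN EVERY
NEIGHBOURHOOD OF EVERY SINGULAR POINT** (`ν > 0`; no named fact): for every `r₀ > 0`, `t₀ < T` and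
`C` there are `t ∈ (t₀, T)` and `x ∈ B(x₁, r₀)` with `cylRadius x · ‖u(t, x)‖ > C`.
[cite: KochNadirashviliSereginSverak2009, Thm 6.1] -/
theorem exists_local_cylRadius_mul_norm_gt (hν : 0 < ν) (h0A : IsAxisymmetric (X.u 0))
    (hfA : ∀ t ∈ Ico 0 X.T, IsAxisymmetric (X.f t)) {x₁ : EuclideanSpace ℝ (Fin 3)}
    (hx₁ : ¬ IsBackwardBoundedAt X.u X.T x₁) {r₀ : ℝ} (hr₀ : 0 < r₀) {t₀ : ℝ} (ht₀ : t₀ < X.T)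
    (C : ℝ) : ∃ t ∈ Ioo t₀ X.T, ∃ x ∈ ball x₁ r₀, C < cylRadius x * ‖X.u t x‖ := by
  by_contra hcon
  push Not at hcon
  exact X.not_local_cylRadius_mul_norm_le_of_isAxisymmetric hν h0A hfA hx₁ hr₀ ht₀ ⟨C, hcon⟩

end ClayBlowup

/-- **Local KNSS 6.1 WITH the force, for designed blow-ups**: `r‖u‖` is unbounded in every
neighbourhood of every singular point of an axisymmetric design. [cite: KochNadirashviliSereginSverak2009, Thm 6.1] -/
theorem DesignedBlowup.exists_local_cylRadius_mul_norm_gt {ν : ℝ} (D : DesignedBlowup ν) (hν : 0 < ν)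
    (h0A : IsAxisymmetric (D.u 0)) (hfA : ∀ t ∈ Ico 0 D.T, IsAxisymmetric (D.f t))
    {x₁ : EuclideanSpace ℝ (Fin 3)} (hx₁ : ¬ IsBackwardBoundedAt D.u D.T x₁) {r₀ : ℝ} (hr₀ : 0 < r₀)
    {t₀ : ℝ} (ht₀ : t₀ < D.T) (C : ℝ) :
    ∃ t ∈ Ioo t₀ D.T, ∃ x ∈ ball x₁ r₀, C < cylRadius x * ‖D.u t x‖ :=
  D.toClayBlowup.exists_local_cylRadius_mul_norm_gt hν h0A hfA hx₁ hr₀ ht₀ C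

end Summit.NavierStokesRegularity.FluidComputer

end
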